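import Summits.BirchSwinnertonDyer.BirchSwinnertonDyer.Theorems.KolyvaginRankRigidityAtTwoChebotarevOneClassAtTwoShifted
import HarnessLib

/-!
# Route `KolyvaginRankRigidityAtTwo`, residual crux R_irr `OffHabitatIrredNonSurjTwoConverse`
# (stmt-BirchSwinnertonDyer-27123, LINE 8 «margin absorbs index»): ONE-CLASS ČEBOTAREV AT `2`
# AT FINITE `2`-ADIC INDEX — the two image inputs abstracted to an INFLATION DEFECT `k` and the
# SIMPLICITY of `E[2]` (helper, PROVED, unconditional; width seat `bsd-line-krr2-p2` g9)

The habitat theorems `exists_mem_torsionFixing_eigenvalue_large` /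
`exists_kolyvaginPrime_gt_two_eigenclass_of_le` (`…ChebotarevOneClassAtTwoShifted`, McCallum 1991
Cor. 3.2 at `p = 2` for ONE eigenclass, one level up, loss two bits) use the surjectivity of the
`2`-adic tower `hρ` and the binder `d_K·Δ_E ∉ ℚ^{×2}` in exactly two places:
(i) `-1 ∈ ρ̄_{E,2^{M'}}(Γ_K)` + Sah at `2`: a class of `H¹(K, E[2^M])` vanishing on
`Γ_{K(E[2^{M'}])}` is killed by `2` (ONE bit of inflation defect);
(ii) `E(K̄)[2]` is a simple `Γ_K`-module (dévissage `torsionBy_le_of_stable_of_pow_smul_ne_zero`).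
Everything else — the Weil-pairing bit, the tree's two-level Steps C–G
(`exists_kolyvaginPrime_gt_of_galoisElement_of_le`), reading `M' ≤ M(ℓ)` — is image-free.

This file re-proves the two theorems with (i) and (ii) as HYPOTHESES:
* `hSah` — **inflation defect ≤ `k` bits**: every `x ∈ H¹(K, E[2^M])` with `[x, g] = 0` for all
  `g ∈ Γ_{K(E[2^{M'}])}` satisfies `2^k x = 0`;
* `hS` — `E(K̄)[2]` is a simple `Γ_K`-module;
and conclusion **loss `k + 1` bits**: Kolyvagin primes `ℓ` at `2` with `M' ≤ M(ℓ)` at whose place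
`2^j κ` is not locally trivial for `j + k + 2 ≤ m`
(`exists_kolyvaginPrime_gt_two_eigenclass_of_inflationDefect`, its `Set.Infinite` form, and the
window-step form `exists_kolyvaginPrime_notMem_two_eigenclass_of_inflationDefect`, defect
`D = k + 1`). The habitat is the instance `k = 1` (companion file `…OffHabitatIrredInflationDefectSah`,
`inflationDefect_one_of_hasSurjectiveModNGaloisRep`). OFF the habitat — the frame of R_irr 27123:
`E(ℚ)[2] = 0`, `2`-adic image of finite index — (ii) holds for every quadratic `K` (the mod-`2`
image over `ℚ` is `C₃` or `S₃`, over `K` still `⊇ C₃`), and (i) holds with `k = k₀` as soon as ONE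
element of `Γ_K` acts on `E[2^{M'}]` as the scalar `1 + 2^{k₀}` (Serre's open image theorem, tree
named fact `serre_adicImage_contains_congruenceSubgroup`; companion file,
`pow_zsmul_eq_zero_of_h1Eval_eq_zero_of_smul_eq_one_add`). So the Čebotarev supply of the KRR
engine (S2 / T5b(a′)) survives at finite index at the price of `k₀ - 1` further bits of margin,
UNIFORMLY in `M, M'` — the kernel form of «margin absorbs index» (item 27123's `why it might fail`;
pen memo H1BOUND, evidence on 27123).

HONEST FRAMING: helper lemmas (`--supports` 27123). Nothing here closes R_irr, U1 28083 or the print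
item 23091; the finite-index swap engine and Kolyvagin's conjecture at `2` are untouched; BSD is NOT
proved by any of this.

References: [McCallumLMS1991] §3 (2), Prop. 3.1, Cor. 3.2; [GrossLMS1991] §9 Prop. 9.1, 9.3;
[Sah1968] Prop. 2.7 (b); [Kolyvagin1991MathAnn] §2 (ref. [1] Prop. 8; Kolyvagin works at finite
index); [SilvermanAEC2009] Thm. III.7.9 (a); [RouseZureickBrown2015]; [WZhang2014] Notations (xii).
-/

set_option autoImplicit false
-- the Theorems namespace of this sub repeats the summit name by design (D-0017 nested layout)
set_option linter.dupNamespace false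

noncomputable section

open scoped Classical Pointwise

namespace Summit.BirchSwinnertonDyer.BirchSwinnertonDyer.Theorems.KolyvaginLowerBoundAtTwo

open WeierstrassCurve Field NumberField IsDedekindDomain
open Literature.NumberTheory.GaloisRepresentations Literature.NumberTheory.EllipticCurves
open Literature.NumberTheory Rat.HeightOneSpectrum

universe u

/-! ### Step B′ with an abstract inflation defect -/

section FiniteIndex

variable {W : WeierstrassCurve ℚ}

/-- Every element of `E(K̄)[2^M]` is killed by `2^M`. [folklore] -/
theorem two_pow_zsmul_geomTorsion_eq_zero {K : Type} [Field K] (V : WeierstrassCurve K) (M : ℕ)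
    (t : geomTorsion V ((2 ^ M : ℕ) : ℤ)) : (2 : ℤ) ^ M • t = 0 := by
  apply Subtype.ext
  rw [AddSubgroupClass.coe_zsmul, ZeroMemClass.coe_zero]
  have := (mem_geomTorsion_iff V _ (t : geomPoints V)).mp t.2
  exact_mod_cast this

set_option maxHeartbeats 800000 in
/-- **Step B′ at `2` with an ABSTRACT inflation defect (one eigenclass, both signs of `Δ_E`,
finite `2`-adic index allowed).** Let `κ ∈ H¹(K, E[2^M])` with `2^{m-1} κ ≠ 0`, `M ≤ M'`, and
assume: (`hSah`) classes of `H¹(K, E[2^M])` vanishing on `Γ_{K(E[2^{M'}])}` are killed by `2^k`;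
(`hS`) `E(K̄)[2]` is a simple `Γ_K`-module. Then some `ρ ∈ Γ_{K(E[2^{M'}])}` has
`2^j (ε τ[κ, ρ] + [κ, ρ]) ≠ 0` for all `j + k + 2 ≤ m` — the value `[κ, (ρ')^τ ρ']` at the
Frobenius of a Kolyvagin prime with `Frob = τρ'`. Ingredients: `hSah` (`k` bits), dévissage from
`hS` (the image of `[κ, ·]` on `Γ_{K(E[2^{M'}])}` contains `E[2^M][2^{m-k}]`, no loss), the
Weil-pairing bit `(1 + ε c₀) E[2^{m-k}] ⊄ E[2^{m-k}][2^{m-k-2}]` (one bit). The habitat theorem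
`exists_mem_torsionFixing_eigenvalue_large` is the case `k = 1`.
[cite: McCallumLMS1991, §3 (2), Prop. 3.1] [cite: GrossLMS1991, §9 Prop. 9.1, 9.3]
[cite: Sah1968, Prop. 2.7 (b)] -/
theorem exists_mem_torsionFixing_eigenvalue_large_of_inflationDefect [W.IsElliptic] {K : Type}
    [Field K] [NumberField K]
    (hS : ∀ H : AddSubgroup (geomTorsion (W.baseChange K) 2),
      (∀ g : absoluteGaloisGroup K, ∀ t ∈ H, g • t ∈ H) → H = ⊥ ∨ H = ⊤)
    {c : K ≃ₐ[ℚ] K} {c₀ : absoluteGaloisGroup ℚ} (hc₀ : IsComplexConjugation (Rat.castHom ℝ) c₀)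
    (ht : IsLiftOfAut c (absGaloisTransport (K := ℚ) (L := K) c₀).toRingEquiv)
    {M M' : ℕ} (hMM' : M ≤ M') {k : ℕ}
    (hSah : ∀ x : galH1Torsion (W.baseChange K) ((2 ^ M : ℕ) : ℤ),
      (∀ g ∈ torsionFixing (W.baseChange K) ((2 ^ M' : ℕ) : ℤ),
        h1Eval (W.baseChange K) ((2 ^ M : ℕ) : ℤ) x g = 0) → (2 : ℤ) ^ k • x = 0)
    (κ : galH1Torsion (W.baseChange K) ((2 ^ M : ℕ) : ℤ))
    {ε : ℤ} (hε : ε = 1 ∨ ε = -1) {m : ℕ} (hm : (2 : ℤ) ^ (m - 1) • κ ≠ 0) :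
    ∃ ρ ∈ torsionFixing (W.baseChange K) ((2 ^ M' : ℕ) : ℤ), ∀ j : ℕ, j + k + 2 ≤ m →
      (2 : ℤ) ^ j • (ε • ht.torsionMap W ((2 ^ M : ℕ) : ℤ)
        (h1Eval (W.baseChange K) ((2 ^ M : ℕ) : ℤ) κ ρ) +
        h1Eval (W.baseChange K) ((2 ^ M : ℕ) : ℤ) κ ρ) ≠ 0 := by
  classical
  haveI : Fact (Nat.Prime 2) := ⟨Nat.prime_two⟩
  have hdvdMM' : ((2 ^ M : ℕ) : ℤ) ∣ ((2 ^ M' : ℕ) : ℤ) := by exact_mod_cast Nat.pow_dvd_pow 2 hMM'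
  have hle := torsionFixing_le_of_dvd (W.baseChange K) hdvdMM'
  by_cases hmk : m < k + 2
  · exact ⟨1, Subgroup.one_mem _, fun j hj ↦ absurd hj (by omega)⟩
  push Not at hmk
  -- (a) inflation defect `≤ k` bits: some evaluation of `κ` on `Γ_{K(E[2^{M'}])}` has order `≥ 2^{m-k}`
  obtain ⟨g₀, hg₀, hg₀ne⟩ : ∃ g₀ ∈ torsionFixing (W.baseChange K) ((2 ^ M' : ℕ) : ℤ),
      (2 : ℤ) ^ (m - 1 - k) • h1Eval (W.baseChange K) ((2 ^ M : ℕ) : ℤ) κ g₀ ≠ 0 := by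
    by_contra! hall
    apply hm
    have h2 : (2 : ℤ) ^ k • ((2 : ℤ) ^ (m - 1 - k) • κ) = 0 :=
      hSah _ fun g hg ↦ by rw [h1Eval_zsmul _ _ _ _ (hle hg)]; exact hall g hg
    rw [smul_smul, ← pow_add] at h2
    have e : k + (m - 1 - k) = m - 1 := by omega
    rwa [e] at h2
  -- the order of `[κ, g₀] ∈ E[2^M]` forces `m - k ≤ M`
  have hmM : m - k ≤ M := by
    by_contra hlt
    apply hg₀ne
    have hkill := two_pow_zsmul_geomTorsion_eq_zero (W.baseChange K) M
      (h1Eval (W.baseChange K) ((2 ^ M : ℕ) : ℤ) κ g₀)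
    have : (2 : ℤ) ^ (m - 1 - k) • h1Eval (W.baseChange K) ((2 ^ M : ℕ) : ℤ) κ g₀ =
        (2 : ℤ) ^ (m - 1 - k - M) • ((2 : ℤ) ^ M • h1Eval (W.baseChange K) ((2 ^ M : ℕ) : ℤ) κ g₀) := by
      rw [smul_smul, ← pow_add, Nat.sub_add_cancel (by omega)]
    rw [this, hkill, zsmul_zero]
  -- (b) the image of `[κ, ·]` on `Γ_{K(E[2^{M'}])}`: stable, hence `⊇ E[2^M][2^{m-k}]`
  set H : AddSubgroup (geomTorsion (W.baseChange K) ((2 ^ M : ℕ) : ℤ)) :=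
    { carrier := {t | ∃ g ∈ torsionFixing (W.baseChange K) ((2 ^ M' : ℕ) : ℤ),
        h1Eval (W.baseChange K) ((2 ^ M : ℕ) : ℤ) κ g = t}
      add_mem' := by
        rintro _ _ ⟨g₁, hg₁, rfl⟩ ⟨g₂, hg₂, rfl⟩
        exact ⟨g₁ * g₂, mul_mem hg₁ hg₂, h1Eval_mul _ _ κ (hle hg₁) g₂⟩
      zero_mem' := ⟨1, Subgroup.one_mem _, h1Eval_one _ _ κ⟩
      neg_mem' := by
        rintro _ ⟨g, hg, rfl⟩
        exact ⟨g⁻¹, inv_mem hg, h1Eval_inv _ _ κ (hle hg)⟩ } with hH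
  have hHstab : ∀ g : absoluteGaloisGroup K, ∀ t ∈ H, g • t ∈ H := by
    rintro g t ⟨g₁, hg₁, rfl⟩
    exact ⟨g * g₁ * g⁻¹, (torsionFixing_normal _ _).conj_mem _ hg₁ g,
      h1Eval_conj _ _ κ g (hle hg₁)⟩
  have hHbig : ∀ t : geomTorsion (W.baseChange K) ((2 ^ M : ℕ) : ℤ),
      (2 : ℤ) ^ (m - k) • t = 0 → t ∈ H := by
    intro t ht
    have e : m - 1 - k + 1 = m - k := by omega
    exact torsionBy_le_of_stable_of_pow_smul_ne_zero (W.baseChange K) M hS (m - 1 - k) H hHstab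
      ⟨_, ⟨g₀, hg₀, rfl⟩, hg₀ne⟩ t (by rw [e]; exact ht)
  -- (c) the Weil-pairing bit over `ℚ`: `x ∈ E[2^M]`, `2^{m-k} x = 0`, `2^{m-k-2}(x + ε c₀ x) ≠ 0`
  obtain ⟨x₀, hx₀⟩ := exists_pow_smul_add_sign_conj_ne_zero W hc₀ (m := m - k) (by omega) hε
  have hdvd : ((2 ^ (m - k) : ℕ) : ℤ) ∣ ((2 ^ M : ℕ) : ℤ) := by
    exact_mod_cast Nat.pow_dvd_pow 2 hmM
  set incl : geomTorsion W ((2 ^ (m - k) : ℕ) : ℤ) →+ geomTorsion W ((2 ^ M : ℕ) : ℤ) :=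
    AddSubgroup.inclusion (W.geomTorsion_le_of_dvd hdvd) with hincl
  have hincl_inj : Function.Injective incl := AddSubgroup.inclusion_injective _
  have hincl_smul : ∀ y, incl (c₀ • y) = c₀ • incl y := fun _ ↦ rfl
  set x := incl x₀ with hx
  have hxkill : (2 : ℤ) ^ (m - k) • x = 0 := by
    apply Subtype.ext
    rw [AddSubgroupClass.coe_zsmul, ZeroMemClass.coe_zero]
    change (2 : ℤ) ^ (m - k) • (x₀ : geomPoints W) = 0
    have := (mem_geomTorsion_iff W _ (x₀ : geomPoints W)).mp x₀.2
    exact_mod_cast this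
  have hxne : (2 : ℤ) ^ (m - k - 2) • (x + ε • c₀ • x) ≠ 0 := by
    intro h0
    apply hx₀
    apply hincl_inj
    rw [map_nsmul, map_add, map_zsmul, hincl_smul, map_zero, ← hx, ← natCast_zsmul]
    exact_mod_cast h0
  -- (d) transport to `E(K̄)[2^M]`
  set θ := RatClosure.torsionEquiv (K := K) W ((2 ^ M : ℕ) : ℤ) with hθ
  have hθc : ∀ P, θ (c₀ • P) = ht.torsionMap W ((2 ^ M : ℕ) : ℤ) (θ P) := fun P ↦
    RatClosure.torsionEquiv_smul_of_lift W ht c₀ (fun _ ↦ rfl) _ P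
  have hx'kill : (2 : ℤ) ^ (m - k) • θ x = 0 := by rw [← map_zsmul, hxkill, map_zero]
  have hx'ne : ∀ j : ℕ, j + k + 2 ≤ m →
      (2 : ℤ) ^ j • (ε • ht.torsionMap W ((2 ^ M : ℕ) : ℤ) (θ x) + θ x) ≠ 0 := by
    intro j hj h0
    apply hxne
    have h1 : (2 : ℤ) ^ j • (x + ε • c₀ • x) = 0 := by
      apply θ.injective
      rw [map_zsmul, map_add, map_zsmul, hθc, map_zero, add_comm]
      exact h0
    rw [show m - k - 2 = (m - k - 2 - j) + j by omega, pow_add, mul_smul, h1, smul_zero]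
  -- (e) `θ x = [κ, ρ]` for some `ρ ∈ Γ_{K(E[2^{M'}])}`
  obtain ⟨ρ, hρT, hρx⟩ : θ x ∈ H := hHbig _ hx'kill
  refine ⟨ρ, hρT, fun j hj ↦ ?_⟩
  rw [hρx]
  exact hx'ne j hj

/-! ### The one-class theorem at `2` at finite index, one level up -/

/-- **Čebotarev at `2` for ONE eigenclass, ONE LEVEL UP, AT FINITE `2`-ADIC INDEX (both signs of
`Δ_E`, loss `k + 1` bits, unconditional).** Let `E = W/ℚ` (globally minimal), `K` imaginary
quadratic with `c ≠ 1` in `Aut(K/ℚ)`, `M ≤ M'`, and assume (`hSah`) the inflation defect of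
`H¹(K, E[2^M])` along `K(E[2^{M'}])/K` is at most `k` bits and (`hS`) `E(K̄)[2]` is a simple
`Γ_K`-module. Let `κ ∈ H¹(K, E[2^M])` with `c_* κ = ε κ` (`ε = ±1`) and `2^{m-1} κ ≠ 0`. Then above
every bound there is a Kolyvagin prime `ℓ` at `2` with `M' ≤ M(ℓ)` (`Frob ℓ = Frob ∞` on
`K(E[2^{M'}])`) at whose place `λ` the classes `2^j κ`, `j + k + 2 ≤ m`, are not locally trivial
(local order `≥ 2^{m-k-1}`). NO surjectivity of the `2`-adic tower and NO binder `d_K·Δ_E ∉ ℚ^{×2}`;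
the habitat theorem `exists_kolyvaginPrime_gt_two_eigenclass_of_le` is the instance `k = 1`.
[cite: McCallumLMS1991, §3 Prop. 3.1, Cor. 3.2] [cite: Kolyvagin1991MathAnn, §2 (ref. [1] Prop. 8)]
[cite: WZhang2014, Notations (xii)] [cite: Sah1968, Prop. 2.7 (b)] -/
theorem exists_kolyvaginPrime_gt_two_eigenclass_of_inflationDefect {N : ℕ} [NeZero N] [W.IsElliptic]
    [W.IsGloballyMinimal] {K : Type} [Field K] [NumberField K] (hK : IsImaginaryQuadratic K)
    (hS : ∀ H : AddSubgroup (geomTorsion (W.baseChange K) 2),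
      (∀ g : absoluteGaloisGroup K, ∀ t ∈ H, g • t ∈ H) → H = ⊥ ∨ H = ⊤)
    {c : K ≃ₐ[ℚ] K} (hc : c ≠ 1) {M M' : ℕ} (hM : 1 ≤ M) (hMM' : M ≤ M') {k : ℕ}
    (hSah : ∀ x : galH1Torsion (W.baseChange K) ((2 ^ M : ℕ) : ℤ),
      (∀ g ∈ torsionFixing (W.baseChange K) ((2 ^ M' : ℕ) : ℤ),
        h1Eval (W.baseChange K) ((2 ^ M : ℕ) : ℤ) x g = 0) → (2 : ℤ) ^ k • x = 0)
    (κ : galH1Torsion (W.baseChange K) ((2 ^ M : ℕ) : ℤ))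
    {ε : ℤ} (hε : ε = 1 ∨ ε = -1) (hκ : conjAct W c ((2 ^ M : ℕ) : ℤ) κ = ε • κ)
    {m : ℕ} (hm : (2 : ℤ) ^ (m - 1) • κ ≠ 0) (b : ℕ) :
    ∃ ℓ : ℕ, b < ℓ ∧ Zhang2014.IsKolyvaginPrime N W K 2 ℓ ∧ M' ≤ Zhang2014.kolyvaginIndex W 2 ℓ ∧
      FrobEqFrobInfty W K (2 ^ M') ℓ ∧
      ∀ v : HeightOneSpectrum (𝓞 K), (ℓ : 𝓞 K) ∈ v.asIdeal → ∀ j : ℕ, j + k + 2 ≤ m →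
        ((2 ^ j : ℕ) : ℤ) • κ ∉
          (W.baseChange K).torsionLocalKer (v.adicCompletion K) ((2 ^ M : ℕ) : ℤ) := by
  classical
  have hp : Nat.Prime 2 := Nat.prime_two
  haveI : Fact (Nat.Prime 2) := ⟨hp⟩
  have hM' : 1 ≤ M' := hM.trans hMM'
  have hdvdMM' : ((2 ^ M : ℕ) : ℤ) ∣ ((2 ^ M' : ℕ) : ℤ) := by exact_mod_cast Nat.pow_dvd_pow 2 hMM'
  have hle := torsionFixing_le_of_dvd (W.baseChange K) hdvdMM'
  -- complex conjugation and its involutive lift to `K̄`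
  obtain ⟨c₀, hc₀⟩ := exists_isComplexConjugation (Rat.castHom ℝ)
  have ht : IsLiftOfAut c (absGaloisTransport (K := ℚ) (L := K) c₀).toRingEquiv :=
    RatClosure.isLiftOfAut_absGaloisTransport_of_isImaginaryQuadratic hK hc hc₀
  have hinv : ∀ x, (absGaloisTransport (K := ℚ) (L := K) c₀).toRingEquiv
      ((absGaloisTransport (K := ℚ) (L := K) c₀).toRingEquiv x) = x := fun x ↦
    RatClosure.absGaloisTransport_absGaloisTransport_of_sq_eq_one hc₀.sq_eq_one x
  -- ### Step B′ (abstract inflation defect)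
  obtain ⟨ρ, hρT, hρv⟩ :=
    exists_mem_torsionFixing_eigenvalue_large_of_inflationDefect hS hc₀ ht hMM' hSah κ hε hm
  -- ### Steps C–G (two levels), above a bound that also clears the bad primes of `E`
  obtain ⟨B₀, hB₀⟩ := exists_gt_hasGoodReductionAt W
  obtain ⟨ℓ, hbℓ, hℓ, hℓN, hℓD, hℓ2, hprime, h32, g, hg, hgT', hloc⟩ :=
    exists_kolyvaginPrime_gt_of_galoisElement_of_le (W := W) (N := N)
      Automorphic.chebotarev_artinRep_of_galoisSide hK hp hMM' hc₀ ht hinv (fun _ : Fin 1 ↦ κ)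
      hρT (max b B₀)
  have hbℓ' : b < ℓ := lt_of_le_of_lt (le_max_left _ _) hbℓ
  have hidx : M' ≤ Zhang2014.kolyvaginIndex W 2 ℓ :=
    le_kolyvaginIndex_of_frobEqFrobInfty hM' hℓ hℓ2 h32
      (hB₀ ℓ hℓ (lt_of_le_of_lt (le_max_right _ _) hbℓ))
  have hkoly : Zhang2014.IsKolyvaginPrime N W K 2 ℓ :=
    ⟨hℓ, hℓN, hℓD, hℓ2, hprime, lt_of_lt_of_le (by omega) hidx⟩
  refine ⟨ℓ, hbℓ', hkoly, hidx, h32, fun v hv j hj hmem ↦ ?_⟩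
  have hκcl : κ ∈ AddSubgroup.closure (Set.range fun _ : Fin 1 ↦ κ) :=
    AddSubgroup.subset_closure (Set.mem_range.mpr ⟨0, rfl⟩)
  have hcl : ((2 ^ j : ℕ) : ℤ) • κ ∈ AddSubgroup.closure (Set.range fun _ : Fin 1 ↦ κ) :=
    AddSubgroup.zsmul_mem _ hκcl _
  have hρg : ρ * g ∈ torsionFixing (W.baseChange K) ((2 ^ M' : ℕ) : ℤ) := mul_mem hρT hgT'
  have hF : ht.conjGalCMH (ρ * g) * (ρ * g) ∈ torsionFixing (W.baseChange K) ((2 ^ M : ℕ) : ℤ) :=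
    mul_mem (ht.conjGalCMH_mem_torsionFixing W hinv _ (hle hρg)) (hle hρg)
  have h0 := (hloc _ hcl v hv).mp hmem
  rw [h1Eval_zsmul _ _ _ _ hF,
    h1Eval_conjGalCMH_mul_mul_of_eigen W ht hinv _ hε hκ (hle hρT) (hle hgT') (hg.2 0)] at h0
  exact hρv j hj (by exact_mod_cast h0)

/-- **The `Set.Infinite` form, finite index, one level up.** [cite: McCallumLMS1991, §3 Cor. 3.2]
[cite: WZhang2014, Notations (xii)] -/
theorem setInfinite_kolyvaginPrime_two_eigenclass_of_inflationDefect {N : ℕ} [NeZero N]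
    [W.IsElliptic] [W.IsGloballyMinimal] {K : Type} [Field K] [NumberField K]
    (hK : IsImaginaryQuadratic K)
    (hS : ∀ H : AddSubgroup (geomTorsion (W.baseChange K) 2),
      (∀ g : absoluteGaloisGroup K, ∀ t ∈ H, g • t ∈ H) → H = ⊥ ∨ H = ⊤)
    {c : K ≃ₐ[ℚ] K} (hc : c ≠ 1) {M M' : ℕ} (hM : 1 ≤ M) (hMM' : M ≤ M') {k : ℕ}
    (hSah : ∀ x : galH1Torsion (W.baseChange K) ((2 ^ M : ℕ) : ℤ),
      (∀ g ∈ torsionFixing (W.baseChange K) ((2 ^ M' : ℕ) : ℤ),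
        h1Eval (W.baseChange K) ((2 ^ M : ℕ) : ℤ) x g = 0) → (2 : ℤ) ^ k • x = 0)
    (κ : galH1Torsion (W.baseChange K) ((2 ^ M : ℕ) : ℤ))
    {ε : ℤ} (hε : ε = 1 ∨ ε = -1) (hκ : conjAct W c ((2 ^ M : ℕ) : ℤ) κ = ε • κ)
    {m : ℕ} (hm : (2 : ℤ) ^ (m - 1) • κ ≠ 0) :
    Set.Infinite {ℓ : ℕ | Zhang2014.IsKolyvaginPrime N W K 2 ℓ ∧
      M' ≤ Zhang2014.kolyvaginIndex W 2 ℓ ∧ FrobEqFrobInfty W K (2 ^ M') ℓ ∧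
      ∀ v : HeightOneSpectrum (𝓞 K), (ℓ : 𝓞 K) ∈ v.asIdeal → ∀ j : ℕ, j + k + 2 ≤ m →
        ((2 ^ j : ℕ) : ℤ) • κ ∉
          (W.baseChange K).torsionLocalKer (v.adicCompletion K) ((2 ^ M : ℕ) : ℤ)} := by
  refine Set.infinite_of_forall_exists_gt fun b ↦ ?_
  obtain ⟨ℓ, hbℓ, hkoly, hidx, h32, hloc⟩ :=
    exists_kolyvaginPrime_gt_two_eigenclass_of_inflationDefect (N := N) hK hS hc hM hMM' hSah κ hε
      hκ hm b
  exact ⟨ℓ, ⟨hkoly, hidx, h32, hloc⟩, hbℓ⟩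

/-- **Window-step form at finite index: a NEW Kolyvagin prime outside a finite set, with the margin
`M + 1 ≤ M(q)`, defect `D = k + 1`.** Under the hypotheses of
`exists_kolyvaginPrime_gt_two_eigenclass_of_inflationDefect` at levels `(M, M + 1)`, with the order of
`κ` given as in the LEAD's window step (`2^{e'} κ ≠ 0` whenever `e' + e < M`), for every finite set
`S` there is a Kolyvagin prime `q ∉ S` at `2` with `M + 1 ≤ M(q)` and a place `v ∋ q` of `K` at which
`2^{e'} κ` is NOT locally trivial whenever `e' + e + k + 1 < M`. (The habitat's
`exists_kolyvaginPrime_notMem_two_eigenclass` has `D = 2 = k + 1` with `k = 1`.)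
[cite: Kolyvagin1991MathAnn, §2 (proof of Thm. 2.2; ref. [1] Prop. 8)]
[cite: McCallumLMS1991, §3 Cor. 3.2] -/
theorem exists_kolyvaginPrime_notMem_two_eigenclass_of_inflationDefect {N : ℕ} [NeZero N]
    [W.IsElliptic] [W.IsGloballyMinimal] {K : Type} [Field K] [NumberField K]
    (hK : IsImaginaryQuadratic K)
    (hS : ∀ H : AddSubgroup (geomTorsion (W.baseChange K) 2),
      (∀ g : absoluteGaloisGroup K, ∀ t ∈ H, g • t ∈ H) → H = ⊥ ∨ H = ⊤)
    {c : K ≃ₐ[ℚ] K} (hc : c ≠ 1) {M : ℕ} (hM : 1 ≤ M) {k : ℕ}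
    (hSah : ∀ x : galH1Torsion (W.baseChange K) ((2 ^ M : ℕ) : ℤ),
      (∀ g ∈ torsionFixing (W.baseChange K) ((2 ^ (M + 1) : ℕ) : ℤ),
        h1Eval (W.baseChange K) ((2 ^ M : ℕ) : ℤ) x g = 0) → (2 : ℤ) ^ k • x = 0)
    (κ : galH1Torsion (W.baseChange K) ((2 ^ M : ℕ) : ℤ))
    {ε : ℤ} (hε : ε = 1 ∨ ε = -1) (hκ : conjAct W c ((2 ^ M : ℕ) : ℤ) κ = ε • κ)
    {e : ℕ} (hord : ∀ e' : ℕ, e' + e < M → ((2 ^ e' : ℕ) : ℤ) • κ ≠ 0) (S : Finset ℕ) :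
    ∃ q : ℕ, q ∉ S ∧ Zhang2014.IsKolyvaginPrime N W K 2 q ∧
      M + 1 ≤ Zhang2014.kolyvaginIndex W 2 q ∧
      ∃ v : HeightOneSpectrum (𝓞 K), ((q : ℕ) : 𝓞 K) ∈ v.asIdeal ∧
        ∀ e' : ℕ, e' + e + k + 1 < M →
          ((2 ^ e' : ℕ) : ℤ) • κ ∉
            (W.baseChange K).torsionLocalKer (v.adicCompletion K) ((2 ^ M : ℕ) : ℤ) := by
  classical
  by_cases hMe : M ≤ e
  · -- the local clause is vacuous: any Kolyvagin prime of index `≥ M + 1` outside `S`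
    obtain ⟨q, hbq, hkoly, hidx, -⟩ := exists_kolyvaginPrime_gt_le_kolyvaginIndex (W := W)
      (N := N) hK hc (M' := M + 1) (by omega) (S.sup id)
    have hqS : q ∉ S := fun h ↦ by
      have := Finset.le_sup (f := id) h
      simp only [id_eq] at this
      omega
    obtain ⟨v, hv⟩ := exists_natCast_mem_of_isKolyvaginPrime (W := W) hkoly
    exact ⟨q, hqS, hkoly, hidx, v, hv, fun e' he' ↦ absurd he' (by omega)⟩
  · push Not at hMe
    have hm : (2 : ℤ) ^ (M - e - 1) • κ ≠ 0 := by
      intro h0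
      apply hord (M - e - 1) (by omega)
      exact_mod_cast h0
    have hinf := setInfinite_kolyvaginPrime_two_eigenclass_of_inflationDefect (N := N) hK hS hc hM
      (Nat.le_succ M) hSah κ hε hκ hm
    obtain ⟨q, hq⟩ := (hinf.sdiff S.finite_toSet).nonempty
    obtain ⟨⟨hkoly, hidx, -, hloc⟩, hqS⟩ := hq
    obtain ⟨v, hv⟩ := exists_natCast_mem_of_isKolyvaginPrime (W := W) hkoly
    exact ⟨q, hqS, hkoly, hidx, v, hv, fun e' he' ↦ hloc v hv e' (by omega)⟩

end FiniteIndex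

end Summit.BirchSwinnertonDyer.BirchSwinnertonDyer.Theorems.KolyvaginLowerBoundAtTwo

end
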